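import Literature.NumberTheory.DiophantineApproximation.ViolaZudilinResidueIntegrals
import Mathlib.MeasureTheory.Function.JacobianOneDim
import HarnessLib

/-!
# `J_z^{(0)}` in the `(ξ, η)` coordinates (Viola–Zudilin (2.5)–(2.7))

Topic `Literature/NumberTheory/DiophantineApproximation`. DEFINITION (`etaIntegrandR`, the real `η`-integrand)
with proved API; no named facts.

For real `z > 1` the substitution `y = η/(η−z)` (VZ (2.5)), `η ∈ (−∞,0) ↦ y ∈ (0,1)`, in the inner integral of
`J₀ z h j k l m q = z^{k−l−q} ∫∫_{[0,1]²} x^j(1−x)^h y^k(1−y)^l (1−y+yz)^N dx dy/(x(1−y)+yz)^{n+1}`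
(`n = j+k−m`, `N = j+q−m`) gives (VZ (2.7), real form, no orientation conventions):

`J₀ z h j k l m q = (−1)^{l+N} ∫₀¹ x^j(1−x)^h ( ∫_{−∞}^0 η^k(1−η)^N dη/((η−x)^{n+1}(η−z)^{l+q+1}) ) dx`

(`J₀_eq_integral_eta`; the `z`-powers cancel exactly: `x(1−y)+yz = z(η−x)/(η−z)`, `1−y+yz = z(η−1)/(η−z)`,
`1−y = −z/(η−z)`, `dy = −z dη/(η−z)²`).

## References

* C. Viola, W. Zudilin, J. reine angew. Math. 736 (2018) 193–223, (2.5)–(2.7). [ViolaZudilin2018]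
-/

noncomputable section

namespace Literature.NumberTheory.DiophantineApproximation

namespace ViolaZudilin

open MeasureTheory Set Filter intervalIntegral
open RhinViola (integrand integrableOn_integrand integrand_eq_div_pow)

variable {z : ℝ}

/-- The real `η`-integrand `η^k(1−η)^N/((η−x)^{n+1}(η−z)^{L+1})`. [cite: ViolaZudilin2018, (2.7)] -/
def etaIntegrandR (k N n L : ℕ) (x z η : ℝ) : ℝ :=
  η ^ k * (1 - η) ^ N / ((η - x) ^ (n + 1) * (η - z) ^ (L + 1))

/-! ### The Möbius substitution `y = η/(η−z)` on `(−∞, 0)` -/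

/-- `η ↦ η/(η−z)` has derivative `−z/(η−z)²`. [cite: ViolaZudilin2018, (2.5)] -/
theorem hasDerivAt_moebius (z : ℝ) {η : ℝ} (hη : η - z ≠ 0) :
    HasDerivAt (fun t : ℝ => t / (t - z)) (-z / (η - z) ^ 2) η := by
  have h : HasDerivAt (fun t : ℝ => t / (t - z)) ((1 * (η - z) - η * 1) / (η - z) ^ 2) η :=
    (hasDerivAt_id' η).div ((hasDerivAt_id' η).sub_const z) hη
  refine h.congr_deriv ?_
  ring

/-- `η ↦ η/(η−z)` is injective on `(−∞,0)` (`z ≠ 0`). [cite: ViolaZudilin2018, (2.5)] -/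
theorem injOn_moebius (hz : 0 < z) : InjOn (fun t : ℝ => t / (t - z)) (Iio 0) := by
  intro a ha b hb hab
  have ha' : a - z ≠ 0 := by simp only [mem_Iio] at ha; linarith
  have hb' : b - z ≠ 0 := by simp only [mem_Iio] at hb; linarith
  simp only at hab
  rw [div_eq_div_iff ha' hb'] at hab
  nlinarith [hab]

/-- The image of `(−∞,0)` under `η ↦ η/(η−z)` is `(0,1)` (`z > 0`). [cite: ViolaZudilin2018, (2.5)] -/
theorem image_moebius_Iio (hz : 0 < z) : (fun t : ℝ => t / (t - z)) '' Iio 0 = Ioo 0 1 := by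
  ext y
  simp only [mem_image, mem_Iio, mem_Ioo]
  constructor
  · rintro ⟨t, ht, rfl⟩
    have htz : t - z < 0 := by linarith
    refine ⟨div_pos_of_neg_of_neg ht htz, ?_⟩
    rw [div_lt_one_of_neg htz]
    linarith
  · rintro ⟨hy0, hy1⟩
    refine ⟨y * z / (y - 1), ?_, ?_⟩
    · exact div_neg_of_pos_of_neg (mul_pos hy0 hz) (by linarith)
    · have hy1' : y - 1 ≠ 0 := by linarith
      field_simp
      ring

/-- The pulled-back factors: with `y = η/(η−z)` one has `1−y = −z/(η−z)`, `x(1−y)+yz = z(η−x)/(η−z)` and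
`1−y+yz = z(η−1)/(η−z)`. [cite: ViolaZudilin2018, (2.5)] -/
theorem moebius_factors (x : ℝ) {η : ℝ} (hη : η - z ≠ 0) :
    1 - η / (η - z) = -z / (η - z) ∧ x * (1 - η / (η - z)) + η / (η - z) * z = z * (η - x) / (η - z) ∧
      1 - η / (η - z) + η / (η - z) * z = z * (η - 1) / (η - z) := by
  refine ⟨?_, ?_, ?_⟩ <;> field_simp <;> ring

/-- The algebra of the substitution (no relations among the exponents). [cite: ViolaZudilin2018, (2.7)] -/
theorem moebius_algebra {x η : ℝ} (hz : z ≠ 0) (hη : η - z ≠ 0) (hηx : η - x ≠ 0) (k l N n : ℕ) :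
    z / (η - z) ^ 2 * ((η / (η - z)) ^ k * (-z / (η - z)) ^ l * (z * (η - 1) / (η - z)) ^ N /
        (z * (η - x) / (η - z)) ^ (n + 1)) =
      (-1) ^ (l + N) * (z ^ (l + N) / z ^ n) * (η ^ k * (1 - η) ^ N / (η - x) ^ (n + 1)) *
        ((η - z) ^ (n + 1) / ((η - z) ^ 2 * (η - z) ^ k * (η - z) ^ l * (η - z) ^ N)) := by
  rw [div_pow, div_pow, div_pow, div_pow, mul_pow, mul_pow, neg_pow,
    show (η - 1) ^ N = (-1) ^ N * (1 - η) ^ N by rw [← neg_pow, neg_sub], pow_add (-1 : ℝ) l N, pow_succ z n]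
  field_simp
  ring

/-- **The inner integral after `y = η/(η−z)`**: for `z > 0`, `0 < x`, `m ≤ j+k`, `m ≤ j+q`,
`∫₀¹ integrand·(1−y+yz)^N dy = x^j(1−x)^h (−1)^{l+N} z^{l+q−k} ∫_{−∞}^0 etaIntegrandR k N n (l+q) x z η dη`.
[cite: ViolaZudilin2018, (2.7)] -/
theorem setIntegral_inner_eq_eta (hz : 0 < z) {x : ℝ} (hx : 0 < x) {j k m q : ℕ} (hm : m ≤ j + k)
    (hq : m ≤ j + q) (h l : ℕ) :
    ∫ y in Icc (0 : ℝ) 1, integrand z h j k l m (x, y) * denom₂ z (x, y) ^ (j + q - m) =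
      x ^ j * (1 - x) ^ h * ((-1) ^ (l + (j + q - m)) * z ^ ((l : ℤ) + q - k)) *
        ∫ η in Iio (0 : ℝ), etaIntegrandR k (j + q - m) (j + k - m) (l + q) x z η := by
  have hz0 : z ≠ 0 := hz.ne'
  rw [integral_Icc_eq_integral_Ioo, ← image_moebius_Iio hz,
    integral_image_eq_integral_abs_deriv_smul measurableSet_Iio
      (fun η hη => (hasDerivAt_moebius z (by simp only [mem_Iio] at hη; linarith)).hasDerivWithinAt)
      (injOn_moebius hz), ← MeasureTheory.integral_const_mul]
  refine setIntegral_congr_fun measurableSet_Iio fun η hη => ?_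
  simp only [mem_Iio] at hη
  have hηz : η - z ≠ 0 := by linarith
  have hηz' : η - z < 0 := by linarith
  have hηx : η - x ≠ 0 := by linarith
  obtain ⟨f1, f2, f3⟩ := moebius_factors (z := z) x hηz
  have hD : denom₁ z (x, η / (η - z)) ≠ 0 := by
    rw [denom₁, f2]; exact div_ne_zero (mul_ne_zero hz0 hηx) hηz
  simp only [smul_eq_mul]
  rw [integrand_eq_div_pow (by omega) hD, show j + k + 1 - m = j + k - m + 1 by omega]
  simp only [denom₁, denom₂]
  rw [f2, f3, f1, abs_div, abs_neg, abs_of_pos hz, abs_of_pos (by positivity : (0 : ℝ) < (η - z) ^ 2)]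
  have hzpow : z ^ (l + (j + q - m)) / z ^ (j + k - m) = z ^ ((l : ℤ) + q - k) := by
    rw [← zpow_natCast, ← zpow_natCast, ← zpow_sub₀ hz0]
    congr 1
    rw [Nat.cast_add, Nat.cast_sub hq, Nat.cast_sub hm]
    push_cast
    ring
  have hηpow : (η - z) ^ (j + k - m + 1) / ((η - z) ^ 2 * (η - z) ^ k * (η - z) ^ l * (η - z) ^ (j + q - m)) =
      1 / (η - z) ^ (l + q + 1) := by
    rw [← pow_add, ← pow_add, ← pow_add, show 2 + k + l + (j + q - m) = (j + k - m + 1) + (l + q + 1) by omega,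
      pow_add]
    field_simp
    ring
  calc z / (η - z) ^ 2 * (x ^ j * (1 - x) ^ h * (η / (η - z)) ^ k * (-z / (η - z)) ^ l /
        (z * (η - x) / (η - z)) ^ (j + k - m + 1) * (z * (η - 1) / (η - z)) ^ (j + q - m))
      = x ^ j * (1 - x) ^ h * (z / (η - z) ^ 2 * ((η / (η - z)) ^ k * (-z / (η - z)) ^ l *
          (z * (η - 1) / (η - z)) ^ (j + q - m) / (z * (η - x) / (η - z)) ^ (j + k - m + 1))) := by ring
    _ = x ^ j * (1 - x) ^ h * ((-1) ^ (l + (j + q - m)) * (z ^ (l + (j + q - m)) / z ^ (j + k - m)) *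
          (η ^ k * (1 - η) ^ (j + q - m) / (η - x) ^ (j + k - m + 1)) *
          ((η - z) ^ (j + k - m + 1) / ((η - z) ^ 2 * (η - z) ^ k * (η - z) ^ l * (η - z) ^ (j + q - m)))) := by
        rw [moebius_algebra hz0 hηz hηx]
    _ = _ := by
        rw [hzpow, hηpow, etaIntegrandR]
        field_simp

/-! ### Fubini and the `(ξ,η)` form of `J₀` -/

/-- The integrand of `J₀` is integrable on the square (`z ≥ 1`). [cite: ViolaZudilin2018, §2.1] -/
theorem integrable_integrand_mul_denom₂_pow (hz : 1 ≤ z) (h j k l m N : ℕ) :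
    Integrable (fun p : ℝ × ℝ => integrand z h j k l m p * denom₂ z p ^ N)
      (((volume : Measure ℝ).restrict (Icc 0 1)).prod ((volume : Measure ℝ).restrict (Icc 0 1))) := by
  have hi : IntegrableOn (fun p => integrand z h j k l m p * denom₂ z p ^ N) unitSquare volume := by
    refine Integrable.mul_of_top_left (integrableOn_integrand hz h j k l m) ?_
    refine memLp_top_of_bound ((continuous_denom₂ z).pow N).aestronglyMeasurable (z ^ N)
      ((ae_restrict_iff' measurableSet_unitSquare).2 (Filter.Eventually.of_forall fun p hp => ?_))
    rw [Real.norm_eq_abs, abs_pow]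
    refine pow_le_pow_left₀ (abs_nonneg _) ?_ N
    rw [mem_unitSquare] at hp
    rw [denom₂, abs_of_nonneg (by nlinarith [hp.2.1, hp.2.2])]
    nlinarith [hp.2.1, hp.2.2]
  rwa [IntegrableOn, volume_restrict_unitSquare] at hi

/-- **`J₀` in the `(ξ,η)` coordinates** (VZ (2.7), real form): for `z > 1`, `m ≤ j+k`, `m ≤ j+q`,
`J₀ z h j k l m q = (−1)^{l+N} ∫₀¹ x^j(1−x)^h (∫_{−∞}^0 η^k(1−η)^N dη/((η−x)^{n+1}(η−z)^{l+q+1})) dx`.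
[cite: ViolaZudilin2018, (2.7)] -/
theorem J₀_eq_integral_eta (hz : 1 < z) {j k m q : ℕ} (hm : m ≤ j + k) (hq : m ≤ j + q) (h l : ℕ) :
    J₀ z h j k l m q = (-1) ^ (l + (j + q - m)) * ∫ x in (0 : ℝ)..1, x ^ j * (1 - x) ^ h *
      ∫ η in Iio (0 : ℝ), etaIntegrandR k (j + q - m) (j + k - m) (l + q) x z η := by
  have hz0 : 0 < z := by linarith
  have hF : ∫ p in unitSquare, integrand z h j k l m p * denom₂ z p ^ (j + q - m) =
      ∫ x in Icc (0 : ℝ) 1, ∫ y in Icc (0 : ℝ) 1, integrand z h j k l m (x, y) * denom₂ z (x, y) ^ (j + q - m) := by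
    rw [show (∫ p in unitSquare, integrand z h j k l m p * denom₂ z p ^ (j + q - m)) =
        ∫ p, integrand z h j k l m p * denom₂ z p ^ (j + q - m)
          ∂((volume : Measure ℝ).restrict (Icc 0 1)).prod ((volume : Measure ℝ).restrict (Icc 0 1)) by
      rw [← volume_restrict_unitSquare]]
    exact integral_prod _ (integrable_integrand_mul_denom₂_pow hz.le h j k l m _)
  rw [J₀, hF, integral_Icc_eq_integral_Ioc, ← intervalIntegral.integral_of_le zero_le_one,
    ← intervalIntegral.integral_const_mul, ← intervalIntegral.integral_const_mul]
  refine intervalIntegral.integral_congr_ae (Filter.Eventually.of_forall fun x hx => ?_)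
  rw [uIoc_of_le zero_le_one] at hx
  rw [setIntegral_inner_eq_eta hz0 hx.1 hm hq h l]
  have hzz : z ^ ((k : ℤ) - l - q) * z ^ ((l : ℤ) + q - k) = 1 := by
    rw [← zpow_add₀ hz0.ne']; ring_nf; exact zpow_zero z
  linear_combination (x ^ j * (1 - x) ^ h * (-1) ^ (l + (j + q - m)) *
    ∫ η in Iio (0 : ℝ), etaIntegrandR k (j + q - m) (j + k - m) (l + q) x z η) * hzz

end ViolaZudilin

end Literature.NumberTheory.DiophantineApproximation

end
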